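import Summits.HodgeConjecture.HodgeConjecture.Theorems.LimitExtensionHodgeFourfoldsLefschetzDischarged
import Literature.AlgebraicGeometry.HodgeTheory.SpreadSupportsOverCurveProofs

/-!
# Route LimitExtension · `HodgeFourfolds` (stmt-HodgeConjecture-10866) — the snc principle discharged: the item is exactly stmt-2998

Since 2026-08-16T18:53Z the snc principle of two types (Deligne, Hodge III, Prop. 8.2.7 for the
members of an snc boundary) is a THEOREM of the tree,
`Literature.AlgebraicGeometry.HodgeTheory.Deligne1974_ker_pullback_eq_ker_pullback_snc_holds`
(file `HodgeTheory/GysinKernelSNC`: GAGA on the strata, `Resolution.smoothOfRelativeDimension_stratum_of_hasSNC`,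
and the compact-Kähler principle of two types `exists_isOpen_map_subsetIncl_eq_zero_of_strata`).
Feeding it into `Theorems/LimitExtensionHodgeFourfoldsLefschetzDischarged` leaves the support item
`HodgeFourfolds` (Hodge models → `LimitExtensionFour` → `HypersurfaceHodgeFour` → the Hodge
conjecture for every smooth projective fourfold) resting on EXACTLY ONE input, the route's
Hodge-free specialisation item `SpecialisationOfAlgebraicity` (stmt-HodgeConjecture-2998):

* `hodgeFourfolds_of_specialisation : SpecialisationOfAlgebraicity → HodgeFourfolds` — no other
  hypothesis; the closing term of the item is `hodgeFourfolds_of_specialisation ‹2998›`.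
* `hodgeFourfolds_of_localSpread` — the same on stmt-2998's registered residual stub
  `localSpread` (spreading of fibrewise algebraic supports for a flat PROPER family over a smooth
  curve: relative Hilbert schemes + flat limits; printed only for projective morphisms).

The item declares four dependencies (`LimitExtensionFour`, `HypersurfaceHodgeFour`,
`SpecialisationOfAlgebraicity`, `HodgeModels`) but binds only three; with the fourth bound it is
now an unconditional theorem:

* `hodgeFourfolds_binder` — Hodge models → `SpecialisationOfAlgebraicity` → `LimitExtensionFour`
  → `HypersurfaceHodgeFour` → `HodgeConjectureFor 4 X` for every smooth projective fourfold `X`.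

Because the `∃`-clause of `LimitExtensionFour` asks of the witness family `f : W ⟶ T` only
flatness and properness, the item as filed contains stmt-2998 at the generality of a merely proper
total space. In the REPAIRED vocabulary proposed for stmt-2995/2996/2998 (insert
`IsQuasiProjectiveOver W`: after `IrreducibleSpace T.left →` in `SpecialisationOfAlgebraicity`, and
after `IsProper f.left` in the `∃`-clause of `LimitExtensionFour`; still implied by the Hodge
conjecture — the pencil of hypersurfaces through a generic projection over an affine curve is
quasi-projective):

* `limitExtension_mem_supportedClasses_four_one_of_specialisation_qp`, `hodgeFourfolds_qp_binder` —
  Hodge models → (2998 with the clause) → (`LimitExtensionFour` with the clause) →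
  `HypersurfaceHodgeFour` → HC for all smooth projective fourfolds, unconditionally;
* `hodgeConjectureFor_four_of_spread_qp` — with the clause, HC for all smooth projective fourfolds
  from the two cruxes and ONE named fact, `spread_supports_over_smoothCurve`;
* `hodgeConjectureFor_four_of_verdier_qp` — equivalently ONE named fact one level down, Verdier's
  generic local triviality `Motives.Verdier1976_genericLocalTriviality`
  (`spread_supports_over_smoothCurve_of_verdier`): the exact trust base of the repaired milestone.

On one fourfold, unconditionally: `hodgeConjectureFor_four_of_supported` — **a smooth projective
complex fourfold all of whose rational `(2,2)`-classes are supported on a divisor satisfies the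
Hodge conjecture.** No definitions, no named facts, no sorry.
-/

noncomputable section

-- every declaration of this problem lives in `Summit.HodgeConjecture.HodgeConjecture.…` (summit = sub-problem)
set_option linter.dupNamespace false

open CategoryTheory AlgebraicGeometry
open Literature.AlgebraicGeometry Literature.AlgebraicGeometry.Motives
open Literature.AlgebraicGeometry.HodgeTheory

namespace Summit.HodgeConjecture.HodgeConjecture.Theorems

/-! ### The item is exactly stmt-2998 -/

/-- **`HodgeFourfolds` (stmt-HodgeConjecture-10866) from the specialisation item alone.** The route
decl `HodgeFourfolds` follows from the route's support item `SpecialisationOfAlgebraicity`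
(stmt-HodgeConjecture-2998) with no further hypothesis: `hodgeFourfolds_of_snc_of_specialisation`
on the theorem `Deligne1974_ker_pullback_eq_ker_pullback_snc_holds` (the snc principle of two types;
Lefschetz `(1,1)`, Kodaira–Serre sections, hard Lefschetz, log resolution, the Gysin lift and Hodge
models being theorems of the tree). Closing term of the item: `hodgeFourfolds_of_specialisation ‹2998›`.
[cite: DeligneHodgeIII1974, Prop. 8.2.7 and Cor. 8.2.8 (p. 40)] [cite: Thomas2005Nodes, Prop. 2]
[cite: VoisinHodgeI2002, Thm. 11.30] [cite: Murre1977, Remark 1 (p. 230)] -/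
theorem hodgeFourfolds_of_specialisation (hSp : Theses.LimitExtension.SpecialisationOfAlgebraicity) :
    Theses.LimitExtension.HodgeFourfolds :=
  hodgeFourfolds_of_snc_of_specialisation Deligne1974_ker_pullback_eq_ker_pullback_snc_holds hSp

/-- **`HodgeFourfolds` from stmt-2998's registered residual stub `localSpread` alone**: for a flat
proper family `f : W ⟶ T` over a smooth irreducible curve whose fibres off `t₀` are smooth
projective `2k`-folds on which `B` is algebraic, ONE Zariski-closed `𝒵 ⊆ W` with
`(≤ k)`-dimensional `t₀`-slice off which `B|_{W_t}` dies for all `t` outside a proper closed subset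
of `T` (relative Hilbert/Chow spreading plus flat limits; for quasi-projective `W` the named fact
`spread_supports_over_smoothCurve`). Proof: `hodgeFourfolds_of_snc_of_localSpread` on the snc theorem.
[cite: VoisinHodgeII2003, §3.3.1 and proof of Thm. 10.19] [cite: Fulton1998, §10.1]
[cite: DeligneHodgeIII1974, Prop. 8.2.7 (p. 40)] -/
theorem hodgeFourfolds_of_localSpread
    (localSpread : ∀ ⦃k : ℕ⦄ ⦃T W : SchemeOver ℂ⦄ (f : W ⟶ T) (t₀ : ComplexPoints T)
      (B : complexBetti W (2 * k)), 0 < k →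
      SmoothOfRelativeDimension 1 T.hom → IrreducibleSpace T.left → Flat f.left →
      IsProper f.left →
      (∀ t : ComplexPoints T, t ≠ t₀ → IsSmoothProjective (2 * k) (fiberOver f t) ∧
        complexBetti.map (fiberι f t) (2 * k) B ∈ algebraicClasses (fiberOver f t) k) →
      ∃ 𝒵 : Set W.left, IsClosed 𝒵 ∧
        (∀ m : ↥(fiberOver f t₀).left, (fiberι f t₀).left.base m ∈ 𝒵 →
          Order.height m + k ≤ (2 * k : ℕ)) ∧
        ∃ S' : Set T.left, IsClosed S' ∧ S' ≠ Set.univ ∧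
          ∀ t : ComplexPoints T, t.pt ∉ S' →
            complexBetti.restrictCompl (fiberOver f t) ((fiberι f t).left.base ⁻¹' 𝒵) (2 * k)
              (complexBetti.map (fiberι f t) (2 * k) B) = 0) :
    Theses.LimitExtension.HodgeFourfolds :=
  hodgeFourfolds_of_snc_of_localSpread Deligne1974_ker_pullback_eq_ker_pullback_snc_holds localSpread

/-! ### The item with its fourth declared dependency bound — unconditional -/

/-- **`HodgeFourfolds` with `SpecialisationOfAlgebraicity` among the binders, unconditionally.**
Hodge models → the route's specialisation item (stmt-HodgeConjecture-2998) → `LimitExtensionFour` →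
`HypersurfaceHodgeFour` → the Hodge conjecture for every smooth projective complex fourfold. Proof:
`hodgeFourfolds_of_specialisation`, its conclusion — the route decl `HodgeFourfolds` — applied.
[cite: DeligneHodgeIII1974, Prop. 8.2.7 (p. 40)] [cite: Thomas2005Nodes, Prop. 2]
[cite: VoisinHodgeI2002, Thm. 11.30] [cite: Murre1977, Remark 1 (p. 230)] -/
theorem hodgeFourfolds_binder :
    (∀ ⦃n : ℕ⦄ ⦃X : SchemeOver ℂ⦄, IsSmoothProjective n X → Nonempty (HodgeModel n X)) →
    Theses.LimitExtension.SpecialisationOfAlgebraicity →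
    Theses.LimitExtension.LimitExtensionFour → Theses.LimitExtension.HypersurfaceHodgeFour →
    ∀ ⦃X : SchemeOver ℂ⦄, IsSmoothProjective 4 X → HodgeConjectureFor 4 X := by
  intro hM hSp hLE hH
  have h : Theses.LimitExtension.HodgeFourfolds := hodgeFourfolds_of_specialisation hSp
  exact h hM hLE hH

/-! ### One fourfold, unconditionally -/

/-- **The Hodge conjecture for a smooth projective complex fourfold from DIVISOR SUPPORT of its
rational `(2,2)`-classes** (unconditional). If every rational `(2,2)`-class of the smooth projective
fourfold `X` lies in `N¹H⁴(X(ℂ); ℂ)` (`supportedClasses X 4 1`), then `HodgeConjectureFor 4 X`: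
`hodgeConjectureFor_four_of_supported_of_snc` (divisor descent at `(3,2)`: log resolution, the snc
principle, the Gysin lift, Lefschetz `(1,1)` on the resolved threefolds; then codimensions
`0, 1, 3, 4, ≥ 5` and the Hodge model) on the snc theorem. This is Thomas's reformulation of the
Hodge conjecture for fourfolds with "nodal hypersurface" weakened to "some divisor".
[cite: Thomas2005Nodes, Thm. 1 and Prop. 2] [cite: DeligneHodgeIII1974, Cor. 8.2.8 (p. 40)]
[cite: VoisinHodgeI2002, Thm. 11.30] [cite: Murre1977, Remark 1 (p. 230)] -/
theorem hodgeConjectureFor_four_of_supported {X : SchemeOver ℂ} (hX : IsSmoothProjective 4 X)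
    (hN : ∀ c : complexBetti X (2 * 2), IsRationalClass c → IsOfHodgeType 4 X (2 * 2) 2 2 c →
      c ∈ supportedClasses X (2 * 2) 1) :
    HodgeConjectureFor 4 X :=
  hodgeConjectureFor_four_of_supported_of_snc Deligne1974_ker_pullback_eq_ker_pullback_snc_holds hX hN

/-! ### The repaired (quasi-projective) vocabulary -/

/-- **Divisor support of rational `(2,2)`-classes from a quasi-projective limit extension and the
specialisation lemma for quasi-projective total spaces.** `hSp` is stmt-HodgeConjecture-2998 with
`IsQuasiProjectiveOver W →` inserted after `IrreducibleSpace T.left →` (the repair proposed by its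
prover), `hLE` the crux `LimitExtensionFour` with `IsQuasiProjectiveOver W` added to its `∃`-clause,
`hH` the crux `HypersurfaceHodgeFour`. Then every rational `(2,2)`-class `c` on a smooth projective
fourfold lies in `N¹H⁴(X(ℂ); ℂ)`: `HypersurfaceHodgeFour` on the smooth hypersurface fibres makes
`B|_{W_t}` algebraic for `t ≠ t₀` (rational by `IsRationalClass.pullback`, of type `(2,2)` by the
family), `hSp` puts `(g ≫ ι_{t₀})^* B` in `N¹`, and `c = (c - (g ≫ ι_{t₀})^* B) + (g ≫ ι_{t₀})^* B`.
Compare `limitExtension_mem_supportedClasses_four_one_qp`, where `hSp` is replaced by the named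
fact `spread_supports_over_smoothCurve` that proves it. [cite: Thomas2005Nodes, Prop. 2]
[cite: Fulton1998, §10.1 and §20.3] [cite: VoisinHodgeII2003, §3.3.1] -/
theorem limitExtension_mem_supportedClasses_four_one_of_specialisation_qp
    (hSp : ∀ ⦃k : ℕ⦄ ⦃X T W : SchemeOver ℂ⦄ (f : W ⟶ T) (t₀ : ComplexPoints T)
      (g : X ⟶ fiberOver f t₀) (B : complexBetti W (2 * k)), 0 < k →
      IsSmoothProjective (2 * k) X → SmoothOfRelativeDimension 1 T.hom → IrreducibleSpace T.left →
      IsQuasiProjectiveOver W → Flat f.left → IsProper f.left →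
      (∃ U : X.left.Opens, (U : Set X.left).Nonempty ∧ IsOpenImmersion (U.ι ≫ g.left)) →
      (∀ t : ComplexPoints T, t ≠ t₀ → IsSmoothProjective (2 * k) (fiberOver f t) ∧
        complexBetti.map (fiberι f t) (2 * k) B ∈ algebraicClasses (fiberOver f t) k) →
      complexBetti.map (g ≫ fiberι f t₀) (2 * k) B ∈ supportedClasses X (2 * k) 1)
    (hLE : ∀ ⦃X : SchemeOver ℂ⦄, IsSmoothProjective 4 X → ∀ α : complexBetti X 4,
      IsRationalClass α → IsOfHodgeType 4 X 4 2 2 α →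
      ∃ (T W : SchemeOver ℂ) (f : W ⟶ T) (t₀ : ComplexPoints T) (g : X ⟶ fiberOver f t₀)
        (B : complexBetti W 4),
        SmoothOfRelativeDimension 1 T.hom ∧ IrreducibleSpace T.left ∧ Flat f.left ∧
        IsProper f.left ∧ IsQuasiProjectiveOver W ∧
        (∃ U : X.left.Opens, (U : Set X.left).Nonempty ∧ IsOpenImmersion (U.ι ≫ g.left)) ∧
        IsRationalClass B ∧
        (∀ t : ComplexPoints T, t ≠ t₀ →
          (∃ d : ℕ, IsSmoothHypersurface 4 d (fiberOver f t)) ∧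
          IsOfHodgeType 4 (fiberOver f t) 4 2 2 (complexBetti.map (fiberι f t) 4 B)) ∧
        α - complexBetti.map (g ≫ fiberι f t₀) 4 B ∈ supportedClasses X 4 1)
    (hH : Theses.LimitExtension.HypersurfaceHodgeFour)
    {X : SchemeOver ℂ} (hX : IsSmoothProjective 4 X) (c : complexBetti X 4)
    (hc : IsRationalClass c) (h22 : IsOfHodgeType 4 X 4 2 2 c) :
    c ∈ supportedClasses X 4 1 := by
  obtain ⟨T, W, f, t₀, g, B, hT, hirr, hflat, hprop, hW, hU, hB, hfib, hdiff⟩ := hLE hX c hc h22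
  have hpull : complexBetti.map (g ≫ fiberι f t₀) 4 B ∈ supportedClasses X 4 1 := by
    refine hSp (k := 2) f t₀ g B two_pos hX hT hirr hW hflat hprop hU fun t ht ↦ ?_
    obtain ⟨⟨d, hd⟩, htype⟩ := hfib t ht
    exact ⟨hd.1, (hH hd).2 2 _ (hB.pullback _) htype⟩
  have h := Submodule.add_mem _ hdiff hpull
  rwa [sub_add_cancel] at h

/-- **`HodgeFourfolds` in the repaired vocabulary, with the specialisation lemma bound,
unconditionally.** Hodge models → (stmt-2998 with `IsQuasiProjectiveOver W`) →
(`LimitExtensionFour` with `IsQuasiProjectiveOver W` in its `∃`-clause) → `HypersurfaceHodgeFour` →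
the Hodge conjecture for every smooth projective fourfold. Proof: the middle degree by
`limitExtension_mem_supportedClasses_four_one_of_specialisation_qp`, then
`hodgeConjectureFor_four_of_supported`. [cite: DeligneHodgeIII1974, Prop. 8.2.7 (p. 40)]
[cite: Murre1977, Remark 1 (p. 230)] [cite: Thomas2005Nodes, Prop. 2] [cite: VoisinHodgeI2002, Thm. 11.30] -/
theorem hodgeFourfolds_qp_binder :
    (∀ ⦃n : ℕ⦄ ⦃X : SchemeOver ℂ⦄, IsSmoothProjective n X → Nonempty (HodgeModel n X)) →
    (∀ ⦃k : ℕ⦄ ⦃X T W : SchemeOver ℂ⦄ (f : W ⟶ T) (t₀ : ComplexPoints T)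
      (g : X ⟶ fiberOver f t₀) (B : complexBetti W (2 * k)), 0 < k →
      IsSmoothProjective (2 * k) X → SmoothOfRelativeDimension 1 T.hom → IrreducibleSpace T.left →
      IsQuasiProjectiveOver W → Flat f.left → IsProper f.left →
      (∃ U : X.left.Opens, (U : Set X.left).Nonempty ∧ IsOpenImmersion (U.ι ≫ g.left)) →
      (∀ t : ComplexPoints T, t ≠ t₀ → IsSmoothProjective (2 * k) (fiberOver f t) ∧
        complexBetti.map (fiberι f t) (2 * k) B ∈ algebraicClasses (fiberOver f t) k) →
      complexBetti.map (g ≫ fiberι f t₀) (2 * k) B ∈ supportedClasses X (2 * k) 1) →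
    (∀ ⦃X : SchemeOver ℂ⦄, IsSmoothProjective 4 X → ∀ α : complexBetti X 4,
      IsRationalClass α → IsOfHodgeType 4 X 4 2 2 α →
      ∃ (T W : SchemeOver ℂ) (f : W ⟶ T) (t₀ : ComplexPoints T) (g : X ⟶ fiberOver f t₀)
        (B : complexBetti W 4),
        SmoothOfRelativeDimension 1 T.hom ∧ IrreducibleSpace T.left ∧ Flat f.left ∧
        IsProper f.left ∧ IsQuasiProjectiveOver W ∧
        (∃ U : X.left.Opens, (U : Set X.left).Nonempty ∧ IsOpenImmersion (U.ι ≫ g.left)) ∧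
        IsRationalClass B ∧
        (∀ t : ComplexPoints T, t ≠ t₀ →
          (∃ d : ℕ, IsSmoothHypersurface 4 d (fiberOver f t)) ∧
          IsOfHodgeType 4 (fiberOver f t) 4 2 2 (complexBetti.map (fiberι f t) 4 B)) ∧
        α - complexBetti.map (g ≫ fiberι f t₀) 4 B ∈ supportedClasses X 4 1) →
    Theses.LimitExtension.HypersurfaceHodgeFour →
    ∀ ⦃X : SchemeOver ℂ⦄, IsSmoothProjective 4 X → HodgeConjectureFor 4 X := by
  intro _hM hSp hLE hH X hX
  exact hodgeConjectureFor_four_of_supported hX fun c hc hpp ↦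
    limitExtension_mem_supportedClasses_four_one_of_specialisation_qp hSp hLE hH hX c hc hpp

/-! ### The exact trust base of the repaired milestone -/

/-- **The Hodge conjecture for all smooth projective fourfolds from the two cruxes and ONE named
fact, granted a quasi-projective witness family**: `hodgeConjectureFor_four_of_two_facts_qp` with
its snc hypothesis discharged by `Deligne1974_ker_pullback_eq_ker_pullback_snc_holds`; the remaining
named fact is the spreading of fibrewise algebraic supports over a smooth curve (`hF`,
`spread_supports_over_smoothCurve`). [cite: VoisinHodgeII2003, §3.3.1 and proof of Thm. 10.19]
[cite: DeligneHodgeIII1974, Prop. 8.2.7 (p. 40)] [cite: Thomas2005Nodes, Prop. 2] -/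
theorem hodgeConjectureFor_four_of_spread_qp (hF : spread_supports_over_smoothCurve)
    (hLE : ∀ ⦃X : SchemeOver ℂ⦄, IsSmoothProjective 4 X → ∀ α : complexBetti X 4,
      IsRationalClass α → IsOfHodgeType 4 X 4 2 2 α →
      ∃ (T W : SchemeOver ℂ) (f : W ⟶ T) (t₀ : ComplexPoints T) (g : X ⟶ fiberOver f t₀)
        (B : complexBetti W 4),
        SmoothOfRelativeDimension 1 T.hom ∧ IrreducibleSpace T.left ∧ Flat f.left ∧
        IsProper f.left ∧ IsQuasiProjectiveOver W ∧
        (∃ U : X.left.Opens, (U : Set X.left).Nonempty ∧ IsOpenImmersion (U.ι ≫ g.left)) ∧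
        IsRationalClass B ∧
        (∀ t : ComplexPoints T, t ≠ t₀ →
          (∃ d : ℕ, IsSmoothHypersurface 4 d (fiberOver f t)) ∧
          IsOfHodgeType 4 (fiberOver f t) 4 2 2 (complexBetti.map (fiberι f t) 4 B)) ∧
        α - complexBetti.map (g ≫ fiberι f t₀) 4 B ∈ supportedClasses X 4 1)
    (hH : Theses.LimitExtension.HypersurfaceHodgeFour) :
    ∀ ⦃X : SchemeOver ℂ⦄, IsSmoothProjective 4 X → HodgeConjectureFor 4 X :=
  hodgeConjectureFor_four_of_two_facts_qp Deligne1974_ker_pullback_eq_ker_pullback_snc_holds hF hLE hH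

/-- **The Hodge conjecture for all smooth projective fourfolds from the two cruxes and Verdier's
generic local triviality.** With `IsQuasiProjectiveOver W` in the `∃`-clause of `LimitExtensionFour`
(`hLE`) and the crux `HypersurfaceHodgeFour` (`hH`), the one remaining input is Verdier 1976
Cor. (5.1) (`hV`, `Motives.Verdier1976_genericLocalTriviality`), which gives the spreading of
fibrewise algebraic supports over a smooth curve by the tree's
`spread_supports_over_smoothCurve_of_verdier`; then `hodgeConjectureFor_four_of_spread_qp`. Hodge
models, Lefschetz `(1,1)`, hard Lefschetz, log resolution, the snc principle and the Gysin lift are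
theorems of the tree. [cite: Verdier1976, Cor. (5.1)] [cite: VoisinHodgeII2003, §3.3.1]
[cite: DeligneHodgeIII1974, Prop. 8.2.7 (p. 40)] [cite: Thomas2005Nodes, Prop. 2] -/
theorem hodgeConjectureFor_four_of_verdier_qp (hV : Verdier1976_genericLocalTriviality)
    (hLE : ∀ ⦃X : SchemeOver ℂ⦄, IsSmoothProjective 4 X → ∀ α : complexBetti X 4,
      IsRationalClass α → IsOfHodgeType 4 X 4 2 2 α →
      ∃ (T W : SchemeOver ℂ) (f : W ⟶ T) (t₀ : ComplexPoints T) (g : X ⟶ fiberOver f t₀)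
        (B : complexBetti W 4),
        SmoothOfRelativeDimension 1 T.hom ∧ IrreducibleSpace T.left ∧ Flat f.left ∧
        IsProper f.left ∧ IsQuasiProjectiveOver W ∧
        (∃ U : X.left.Opens, (U : Set X.left).Nonempty ∧ IsOpenImmersion (U.ι ≫ g.left)) ∧
        IsRationalClass B ∧
        (∀ t : ComplexPoints T, t ≠ t₀ →
          (∃ d : ℕ, IsSmoothHypersurface 4 d (fiberOver f t)) ∧
          IsOfHodgeType 4 (fiberOver f t) 4 2 2 (complexBetti.map (fiberι f t) 4 B)) ∧
        α - complexBetti.map (g ≫ fiberι f t₀) 4 B ∈ supportedClasses X 4 1)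
    (hH : Theses.LimitExtension.HypersurfaceHodgeFour) :
    ∀ ⦃X : SchemeOver ℂ⦄, IsSmoothProjective 4 X → HodgeConjectureFor 4 X :=
  hodgeConjectureFor_four_of_spread_qp (spread_supports_over_smoothCurve_of_verdier hV) hLE hH

end Summit.HodgeConjecture.HodgeConjecture.Theorems

end
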